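import Literature.Probability.LatticeModels.TorusFourierDecayFromDifferences
import Mathlib.Analysis.SpecialFunctions.Pow.Real
import Mathlib.Analysis.SpecialFunctions.Sqrt
import HarnessLib

/-!
# `ℓ¹` norms of lattice Fourier sums on the torus from `ℓ²` norms of symbol differences (weighted Plancherel)

Topic `Literature/Probability/LatticeModels`; the `L²` companion of `TorusFourierDecayFromDifferences.lean`.  There a
character sum `g(x) = Σ_k χ_k(x) ĝ(k)` over the dual torus `(ℤ/Lℤ)^d` is shown to decay POINTWISE from the `ℓ¹` norms of
the iterated differences of its symbol (discrete integration by parts, a sup-norm estimate).  For the `L¹` norms of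
single-scale fermionic propagators whose symbol is large on a thin shell — `1/(ik₀ - E(k))` on `|k₀| ≍ a` — the sup-norm
route loses a factor (shell measure)^{-1/2} against the truth; the sharp route is PLANCHEREL with weights: by
`Σ_k χ_k(x) (Δ_v^N ĝ)(k) = (conj χ_v(x) - 1)^N g(x)` and the chord bound `‖χ_v(x) - 1‖ ≥ 4|ã_v(x)|/L`,

  `Σ_x (4|ã_v(x)|/L)^{2N} ‖g(x)‖² ≤ L^d Σ_k ‖(Δ_v^N ĝ)(k)‖²`   (`sum_weight_mul_norm_sq_le`),

so that a weight `W(x) = 1 + Σ_i c_i (4|ã_{v_i}(x)|/L)^{2N}` is paid by `ℓ²` norms of differences of the symbol, and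
Cauchy–Schwarz `Σ_x ‖g(x)‖ ≤ (Σ_x W(x)⁻¹)^{1/2} (Σ_x W(x)‖g(x)‖²)^{1/2}` (`sum_norm_le_of_weight`) turns them into an
`ℓ¹` bound (`sum_norm_sum_torusChar_le`).  This is the estimate behind `‖g^{(h)}‖_{L¹} ≲ γ^{-3h/2}` for an isotropic
(sector-free) single-scale propagator in `d = 2` (Benfatto–Giuliani–Mastropietro 2006, Lemma 2.2 / footnote ¹ at finite
`L`, read without sectors; Feldman–Knörrer–Trubowitz's `L¹–L^∞` power counting), used by the finite-slice engine of the
`βU ≤ κ` corner of the Hubbard two-point function (cell gate-hubbard-kl, R0-SCOPE-2).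

* `sum_norm_sq_sum_torusChar_mul` — Plancherel for character sums: `Σ_x ‖Σ_k χ_k(x) h(k)‖² = L^d Σ_k ‖h(k)‖²`;
* **`sum_weight_mul_norm_sq_le`** — the weighted Plancherel inequality above;
* (private) `sum_norm_le_of_weight` — Cauchy–Schwarz with a positive weight;
* **`sum_norm_sum_torusChar_le`** — the `ℓ¹` bound with the additive weight of a finite family of directions.

Everything is proved; no definitions, no named facts.

## Sources

G. Benfatto, A. Giuliani, V. Mastropietro, Ann. Henri Poincaré 7 (2006) 809–898, Lemma 2.2, (2.36aa) and footnote ¹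
(`BenfattoGiulianiMastropietro2006`); S. Friedli, Y. Velenik, *Statistical Mechanics of Lattice Systems* (2017), §10.4
(`FriedliVelenik2017`).
-/

noncomputable section

open Finset Complex
open scoped Real ComplexConjugate

namespace Literature.Probability.LatticeModels

variable {d L : ℕ} [NeZero L]

/-- **Plancherel for character sums**: `Σ_x ‖Σ_k χ_k(x) h(k)‖² = L^d Σ_k ‖h(k)‖²` on `(ℤ/Lℤ)^d` (the roles of position and
momentum exchanged in `torusFourier_plancherel`; `χ_k(x) = χ_x(k)`). [cite: FriedliVelenik2017, §10.4] -/
theorem sum_norm_sq_sum_torusChar_mul (h : TorusSite d L → ℂ) :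
    ∑ x : TorusSite d L, ‖∑ k, torusChar k x * h k‖ ^ 2 = (L : ℝ) ^ d * ∑ k, ‖h k‖ ^ 2 := by
  have hF : ∀ x : TorusSite d L, ‖∑ k, torusChar k x * h k‖ = ‖torusFourier (fun k => conj (h k)) x‖ := by
    intro x
    rw [torusFourier_eq_sum_torusChar]
    have : ∑ k, conj (h k) * conj (torusChar x k) = conj (∑ k, torusChar k x * h k) := by
      rw [map_sum]
      refine sum_congr rfl fun k _ => ?_
      rw [map_mul, torusChar_comm x k, mul_comm]
    rw [this, Complex.norm_conj]
  simp_rw [hF]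
  have hP := torusFourier_plancherel_holds (d := d) (L := L) (fun k => conj (h k))
  simp_rw [Complex.norm_conj] at hP
  exact hP

/-- **Weighted Plancherel**: for a direction `v` of the dual torus and `N` differences,
`Σ_x (4|ã_v(x)|/L)^{2N} ‖Σ_k χ_k(x) h(k)‖² ≤ L^d Σ_k ‖(Δ_v^N h)(k)‖²`, `ã_v(x)` the minimal representative of `Σ_j v_j x_j`
— polynomial weights in position are paid by `ℓ²` norms of iterated differences of the symbol.
[cite: BenfattoGiulianiMastropietro2006, Lemma 2.2 and (2.36aa)] -/
theorem sum_weight_mul_norm_sq_le (h : TorusSite d L → ℂ) (v : TorusSite d L) (N : ℕ) :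
    ∑ x : TorusSite d L, (4 * |((∑ j, v j * x j).valMinAbs : ℝ)| / L) ^ (2 * N) * ‖∑ k, torusChar k x * h k‖ ^ 2 ≤
      (L : ℝ) ^ d * ∑ k, ‖((fwdDiff v)^[N] h) k‖ ^ 2 := by
  rw [← sum_norm_sq_sum_torusChar_mul]
  refine sum_le_sum fun x _ => ?_
  have hconj : ‖conj (torusChar v x) - 1‖ = ‖torusChar v x - 1‖ := by
    rw [show conj (torusChar v x) - 1 = conj (torusChar v x - 1) by rw [map_sub, map_one], Complex.norm_conj]
  have hid : ∑ k, torusChar k x * ((fwdDiff v)^[N] h) k = (conj (torusChar v x) - 1) ^ N * ∑ k, torusChar k x * h k := by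
    have := sum_torusChar_smul_fwdDiff_iter (E := ℂ) v x N h
    simpa only [smul_eq_mul] using this
  have hpt : (4 * |((∑ j, v j * x j).valMinAbs : ℝ)| / L) ^ N * ‖∑ k, torusChar k x * h k‖ ≤
      ‖∑ k, torusChar k x * ((fwdDiff v)^[N] h) k‖ := by
    rw [hid, norm_mul, norm_pow, hconj]
    exact mul_le_mul_of_nonneg_right (pow_le_pow_left₀ (by positivity) (le_norm_torusChar_sub_one v x) N) (norm_nonneg _)
  have h0 : 0 ≤ (4 * |((∑ j, v j * x j).valMinAbs : ℝ)| / L) ^ N * ‖∑ k, torusChar k x * h k‖ := by positivity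
  calc (4 * |((∑ j, v j * x j).valMinAbs : ℝ)| / L) ^ (2 * N) * ‖∑ k, torusChar k x * h k‖ ^ 2
      = ((4 * |((∑ j, v j * x j).valMinAbs : ℝ)| / L) ^ N * ‖∑ k, torusChar k x * h k‖) ^ 2 := by
        rw [mul_comm 2 N, pow_mul]; ring
    _ ≤ ‖∑ k, torusChar k x * ((fwdDiff v)^[N] h) k‖ ^ 2 := pow_le_pow_left₀ h0 hpt 2

omit [NeZero L] in
/-- **Cauchy–Schwarz with a positive weight**: `Σ_x ‖g(x)‖ ≤ (Σ_x W(x)⁻¹)^{1/2} (Σ_x W(x) ‖g(x)‖²)^{1/2}`. [folklore] -/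
private theorem sum_norm_le_of_weight {ι : Type*} (s : Finset ι) (g : ι → ℂ) (W : ι → ℝ) (hW : ∀ x ∈ s, 0 < W x) :
    ∑ x ∈ s, ‖g x‖ ≤ Real.sqrt (∑ x ∈ s, (W x)⁻¹) * Real.sqrt (∑ x ∈ s, W x * ‖g x‖ ^ 2) := by
  have hcs := sum_mul_sq_le_sq_mul_sq s (fun x => Real.sqrt ((W x)⁻¹)) (fun x => Real.sqrt (W x) * ‖g x‖)
  have hprod : ∀ x ∈ s, Real.sqrt ((W x)⁻¹) * (Real.sqrt (W x) * ‖g x‖) = ‖g x‖ := by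
    intro x hx
    have hWx := hW x hx
    rw [← mul_assoc, Real.sqrt_inv, inv_mul_cancel₀ (Real.sqrt_ne_zero'.2 hWx), one_mul]
  have h1 : ∀ x ∈ s, Real.sqrt ((W x)⁻¹) ^ 2 = (W x)⁻¹ := fun x hx =>
    Real.sq_sqrt (inv_nonneg.2 (hW x hx).le)
  have h2 : ∀ x ∈ s, (Real.sqrt (W x) * ‖g x‖) ^ 2 = W x * ‖g x‖ ^ 2 := fun x hx => by
    rw [mul_pow, Real.sq_sqrt (hW x hx).le]
  rw [sum_congr rfl hprod, sum_congr rfl h1, sum_congr rfl h2] at hcs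
  have hA : 0 ≤ ∑ x ∈ s, (W x)⁻¹ := sum_nonneg fun x hx => inv_nonneg.2 (hW x hx).le
  have hB : 0 ≤ ∑ x ∈ s, W x * ‖g x‖ ^ 2 := sum_nonneg fun x hx => mul_nonneg (hW x hx).le (sq_nonneg _)
  have hS : 0 ≤ ∑ x ∈ s, ‖g x‖ := sum_nonneg fun x _ => norm_nonneg _
  rw [← Real.sqrt_mul hA, ← Real.sqrt_sq hS]
  exact Real.sqrt_le_sqrt hcs

/-- **The `ℓ¹` norm of a character sum from `ℓ²` norms of symbol differences**: for a finite family of directions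
`v i` with nonnegative coefficients `c i` and `N` differences, with the additive weight
`W(x) = 1 + Σ_i c_i (4|ã_{v_i}(x)|/L)^{2N}`,
`Σ_x ‖Σ_k χ_k(x) h(k)‖ ≤ (Σ_x W(x)⁻¹)^{1/2} · (L^d [Σ_k ‖h(k)‖² + Σ_i c_i Σ_k ‖(Δ_{v_i}^N h)(k)‖²])^{1/2}` — the weighted
Plancherel route to the `L¹` norm of a single-scale lattice propagator (the geometry of the weight, `Σ_x W⁻¹ ≍`
(decay volume), is left to the user). [cite: BenfattoGiulianiMastropietro2006, Lemma 2.2 and footnote 1] -/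
theorem sum_norm_sum_torusChar_le {ι : Type*} (T : Finset ι) (v : ι → TorusSite d L) (c : ι → ℝ) (hc : ∀ i ∈ T, 0 ≤ c i)
    (N : ℕ) (h : TorusSite d L → ℂ) :
    ∑ x : TorusSite d L, ‖∑ k, torusChar k x * h k‖ ≤
      Real.sqrt (∑ x : TorusSite d L, (1 + ∑ i ∈ T, c i * (4 * |((∑ j, v i j * x j).valMinAbs : ℝ)| / L) ^ (2 * N))⁻¹) *
        Real.sqrt ((L : ℝ) ^ d * (∑ k, ‖h k‖ ^ 2 + ∑ i ∈ T, c i * ∑ k, ‖((fwdDiff (v i))^[N] h) k‖ ^ 2)) := by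
  set W : TorusSite d L → ℝ := fun x => 1 + ∑ i ∈ T, c i * (4 * |((∑ j, v i j * x j).valMinAbs : ℝ)| / L) ^ (2 * N)
    with hW
  have hWpos : ∀ x ∈ (univ : Finset (TorusSite d L)), 0 < W x := fun x _ => by
    rw [hW]
    exact add_pos_of_pos_of_nonneg one_pos (sum_nonneg fun i hi => mul_nonneg (hc i hi) (by positivity))
  refine (sum_norm_le_of_weight univ (fun x => ∑ k, torusChar k x * h k) W hWpos).trans ?_
  refine mul_le_mul_of_nonneg_left (Real.sqrt_le_sqrt ?_) (Real.sqrt_nonneg _)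
  -- `Σ_x W(x) ‖g(x)‖² ≤ L^d (Σ‖h‖² + Σ_i c_i Σ ‖Δ^N h‖²)`
  have hsplit : ∑ x, W x * ‖∑ k, torusChar k x * h k‖ ^ 2 =
      ∑ x, ‖∑ k, torusChar k x * h k‖ ^ 2 +
        ∑ i ∈ T, c i * ∑ x, (4 * |((∑ j, v i j * x j).valMinAbs : ℝ)| / L) ^ (2 * N) * ‖∑ k, torusChar k x * h k‖ ^ 2 := by
    simp only [hW, add_mul, one_mul, sum_add_distrib, sum_mul]
    congr 1
    rw [sum_comm]
    refine sum_congr rfl fun i _ => ?_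
    rw [mul_sum]
    refine sum_congr rfl fun x _ => ?_
    ring
  rw [hsplit, sum_norm_sq_sum_torusChar_mul, mul_add]
  refine add_le_add le_rfl ?_
  rw [mul_sum]
  refine sum_le_sum fun i hi => ?_
  rw [mul_left_comm]
  exact mul_le_mul_of_nonneg_left (sum_weight_mul_norm_sq_le h (v i) N) (hc i hi)

end Literature.Probability.LatticeModels

end
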